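import Literature.MathematicalPhysics.QuantumFieldTheory.Balaban1983to89.T4ShellMeasure
import Summits.QuantumFields.BalabanUV.T4Continuum.Spine.NE7c.LiveFactorGlobalLevels

/-!
# `T4Continuum.Spine.NE7c.LiveFactorGlobalCompact` — spine estimate NE7c (node U5b), road (δ) THRESHOLD RANDOMISATION,
# member (δ-global) WITHOUT the older-only reading (R↓): ONE threshold assignment for every cutoff from the own-level
# candidate sums (L2↓) alone — grid averaging on the truncations + compactness of the candidate grid
# (cell `pub-balaban-gaps`, track G2, seat ne8 gen 8; record `HOME/ne/NE7c.md` §15)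

HONEST FRAMING.  Finite four-torus programme, rung (B)+1 only — NOT infinite volume, NOT a mass gap, NOT the Clay
problem, NOT summit progress, NOT a proof of NE7c (`T4IndicatorShell.ShellWeightBound`, INSTANCE 0∕1, which waits on
node O).  Nothing of [Bałaban 1983–89] is asserted: the manuscripts fix their thresholds ONCE; threshold randomisation
(road (δ), `Lit.T4ShellMeasure` §6–§8, [folklore]) is the cell's device, and everything below is finite-sum algebra over
abstract nonnegative weights plus Tychonoff's theorem for `ℕ → ℕ`.  Every input is an explicit hypothesis; no `def`;
0 sorry.  Spine PROVED 0∕9 — unchanged by this file.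

WHAT THIS FILE REMOVES.  `LiveFactorGlobalLevels.exists_global_level_assignment` (gen 7, p352520) chooses the global
assignment by INDUCTION ON THE LEVEL and so needs the located reading (R↓) «the level-`j` candidate shell weight of a
comparison, summed over the terms, depends on the assignment only through the levels `≤ j`» — an ORDERING condition on
the expansion's decision tree (every level-`j` threshold test inserted before every younger-level test) that print does
not state (a step's inherited tests carry OLDER levels' thresholds, B14 (3.8) ∕ p. 264, and sit inside components
decided by the step's own tests) and that `Lit.T4ShellMeasure` §8 sidesteps for member (δ-stages) by taking STAGES as
coordinates.  Grid averaging needs no ordering (`Lit.T4ShellMeasure` §7: «must NOT be iterated level by level.  The cure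
is to average over the whole grid»), but a global assignment has infinitely many coordinates.  HERE: (§2) on each
TRUNCATION `j < J` (other coordinates frozen at candidate `0`) average over the finite grid — (L2↓) bounds every
coordinate fibre, so the level-`j` excess set `{t_j·e_j < X_j}` has density `≤ 1/t_j` (Markov) and a union bound with
`Σ_{j<J} 1/t_j < 1` leaves ONE truncated assignment good at EVERY level `j < J` (`exists_truncated_assignment`); (§3) the
sets of grid assignments good below `J` are nonempty, decreasing, and CLOSED in the product topology because each
comparison's weights see the assignment through FINITELY MANY levels (hypothesis (FD) — true of any expansion with
finitely many steps), so by compactness of the grid they share a point: ONE assignment good at every level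
(`exists_global_assignment_compact`); (§4) end to end as gen 7's §3 with (R↓) replaced by (FD) and the level budget
weighted by `t_j`: `T4IndicatorShell.ShellWeightBound` BY NAME for the two runs written with the SAME `c` at every
cutoff (`shellWeightBound_of_globalCompact`); (§5) loss factors: `t_j = (1 − η)⁻¹η^{−j}` keeps a geometric window
majorant at rate `ϑ/η`, `ϑ ≤ η < 1` (`window_sum_le_geometric_weighted`); polynomial `t_j = (j+1)(j+2)` also qualifies.

INPUTS LEFT (located, NOT discharged): (L2↓) (`Lit.T4ShellMeasure` §8's cascade count restricted to the stages carrying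
level-`j` tests, pointwise, whatever their interleaving); (FD); floors; the realized ledgers' tilts (input (L1-levelwise),
census `HOME/ne/NE7c.md` §14); the window majorant (U1b ∕ (W1)); node O.  PRICE: gen 7's level budget times `t_j` — shell
fraction `≤ C·(ϑ/η)^K` instead of `C·ϑ^K`.  NE7c NOT proved.
-/


namespace Summit.QuantumFields.BalabanUV.T4Continuum.Spine.NE7c.LiveFactorGlobalCompact

open Finset
open Literature.MathematicalPhysics.QuantumFieldTheory.Balaban1983to89
open Literature.MathematicalPhysics.QuantumFieldTheory.Balaban1983to89.T4ShellMeasure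
open Summit.QuantumFields.BalabanUV.T4Continuum.Spine.NE7c.LiveFactorGlobalLevels

/-! ## §1 The zero extension of a truncated assignment (`Function.extend Fin.val r (fun _ => 0)`) -/

/-- below the truncation height the zero extension reads the truncated assignment. [folklore] -/
theorem extend_val_apply_lt {D : ℕ} (r : Fin D → ℕ) {l : ℕ} (hl : l < D) :
    Function.extend Fin.val r (fun _ => 0) l = r ⟨l, hl⟩ :=
  Fin.val_injective.extend_apply r (fun _ => 0) ⟨l, hl⟩

/-- at and above the truncation height the zero extension reads `0`. [folklore] -/
theorem extend_val_apply_ge {D : ℕ} (r : Fin D → ℕ) {l : ℕ} (hl : D ≤ l) :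
    Function.extend Fin.val r (fun _ => 0) l = 0 := by
  refine Function.extend_apply' r (fun _ => 0) l ?_
  rintro ⟨i, rfl⟩
  exact absurd i.isLt (not_lt.mpr hl)

/-- the zero extension of a truncated grid assignment lies in the full candidate grid. [folklore] -/
theorem extend_val_mem_grid {n : ℕ → ℕ} (hn : ∀ l, 0 < n l) {D : ℕ} {r : Fin D → ℕ} (hr : ∀ i, r i < n i)
    (l : ℕ) : Function.extend Fin.val r (fun _ => 0) l < n l := by
  by_cases hl : l < D
  · rw [extend_val_apply_lt r hl]; exact hr ⟨l, hl⟩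
  · rw [extend_val_apply_ge r (not_lt.mp hl)]; exact hn l

/-- zero extension commutes with updating one coordinate. [folklore] -/
theorem extend_val_update {D : ℕ} (r : Fin D → ℕ) (i : Fin D) (m : ℕ) :
    Function.extend Fin.val (Function.update r i m) (fun _ => 0)
      = Function.update (Function.extend Fin.val r (fun _ => 0)) i.val m := by
  funext l
  by_cases hl : l < D
  · rw [extend_val_apply_lt _ hl]
    rcases eq_or_ne (⟨l, hl⟩ : Fin D) i with h | h
    · rw [h, Function.update_self, show l = i.val from congrArg Fin.val h, Function.update_self]
    · have hne : l ≠ i.val := fun h' => h (Fin.ext h')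
      rw [Function.update_of_ne h, Function.update_of_ne hne, extend_val_apply_lt r hl]
  · have hne : l ≠ i.val := fun h' => hl (h' ▸ i.isLt)
    rw [Function.update_of_ne hne, extend_val_apply_ge _ (not_lt.mp hl), extend_val_apply_ge _ (not_lt.mp hl)]

/-! ## §2 One truncation: grid averaging, Markov, union bound -/

/-- MARKOV ON A FINITE SET: nonnegative `f` with `Σ_G f ≤ #G·e` (`e ≥ 0`) exceeds `t·e` (`t > 0`) on at most `#G/t`
points. [folklore] -/
theorem card_filter_exceed_le {γ : Type*} (G : Finset γ) (f : γ → ℝ) (hf : ∀ g ∈ G, 0 ≤ f g) {e t : ℝ}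
    (he : 0 ≤ e) (ht : 0 < t) (hsum : ∑ g ∈ G, f g ≤ (G.card : ℝ) * e) :
    (((G.filter fun g => t * e < f g).card : ℕ) : ℝ) ≤ G.card / t := by
  classical
  rcases he.eq_or_lt with h0 | hpos
  · -- `e = 0`: `f` vanishes on `G`, nobody exceeds
    have hzero : ∀ g ∈ G, f g = 0 :=
      (sum_eq_zero_iff_of_nonneg hf).mp (le_antisymm (by simpa [← h0] using hsum) (sum_nonneg hf))
    have hempty : (G.filter fun g => t * e < f g) = ∅ :=
      filter_eq_empty_iff.mpr fun g hg => by rw [hzero g hg, ← h0, mul_zero]; exact lt_irrefl 0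
    rw [hempty, card_empty, Nat.cast_zero]
    positivity
  · set S := G.filter fun g => t * e < f g with hS
    have h1 : (S.card : ℝ) * (t * e) ≤ ∑ g ∈ S, f g := by
      rw [← nsmul_eq_mul, ← sum_const]
      exact sum_le_sum fun g hg => (mem_filter.mp hg).2.le
    have h2 : ∑ g ∈ S, f g ≤ ∑ g ∈ G, f g :=
      sum_le_sum_of_subset_of_nonneg (filter_subset _ _) fun g hg _ => hf g hg
    have h3 : (S.card : ℝ) * t * e ≤ (G.card : ℝ) * e := by rw [mul_assoc]; exact h1.trans (h2.trans hsum)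
    rw [le_div_iff₀ ht]
    exact le_of_mul_le_mul_right h3 hpos

/-- **ONE TRUNCATION, EVERY LEVEL BELOW IT AT ONCE.**  Levels `j` with `n j ≥ 1` candidates, comparisons `B j` booking
level `j`, the two runs' level-`j` candidate shell weights `wA K j c, wB K j c ≥ 0` of an assignment `c : ℕ → ℕ`, positive
floors `ZA K, ZB K`, and (L2↓): inside the candidate grid the `n j` candidates of level `j` (other levels frozen) carry
total weight `≤ V j ×` the floor.  For loss factors `t j > 0` with `Σ_{j<J} 1/t j < 1` ONE grid assignment (vanishing
from level `J` on) has, at EVERY level `j < J`, `Σ_{K ∈ B j} (wA/ZA + wB/ZB) ≤ t j · 2·#(B j)·V j/n j`.  Proof: average over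
the truncated grid fibre by fibre (no older-only dependence needed), Markov per level, union bound. [folklore] -/
theorem exists_truncated_assignment (n : ℕ → ℕ) (hn : ∀ j, 0 < n j) (B : ℕ → Finset ℕ)
    (wA wB : ℕ → ℕ → (ℕ → ℕ) → ℝ) (ZA ZB : ℕ → ℝ) (hZA : ∀ K, 0 < ZA K) (hZB : ∀ K, 0 < ZB K)
    (hA0 : ∀ K j c, 0 ≤ wA K j c) (hB0 : ∀ K j c, 0 ≤ wB K j c) (V : ℕ → ℝ) (hV : ∀ j, 0 ≤ V j)
    (hA : ∀ K j (c : ℕ → ℕ), (∀ l, c l < n l) →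
      ∑ m ∈ range (n j), wA K j (Function.update c j m) ≤ V j * ZA K)
    (hB : ∀ K j (c : ℕ → ℕ), (∀ l, c l < n l) →
      ∑ m ∈ range (n j), wB K j (Function.update c j m) ≤ V j * ZB K)
    (t : ℕ → ℝ) (ht0 : ∀ j, 0 < t j) (J : ℕ) (ht : ∑ j ∈ range J, (t j)⁻¹ < 1) :
    ∃ c : ℕ → ℕ, (∀ l, c l < n l) ∧ (∀ l, J ≤ l → c l = 0) ∧
      ∀ j, j < J → ∑ K ∈ B j, (wA K j c / ZA K + wB K j c / ZB K)
        ≤ t j * (2 * ((B j).card : ℝ) * V j / n j) := by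
  classical
  set G : Finset (Fin J → ℕ) := candGrid fun i : Fin J => n i with hG
  set E : (Fin J → ℕ) → (ℕ → ℕ) := fun r => Function.extend Fin.val r (fun _ => 0) with hE
  have hGne : G.Nonempty := candGrid_nonempty fun i => hn i
  have hEgrid : ∀ r ∈ G, ∀ l, E r l < n l := fun r hr =>
    extend_val_mem_grid hn (fun i => (mem_candGrid.mp hr) i)
  set X : ℕ → (ℕ → ℕ) → ℝ := fun j c => ∑ K ∈ B j, (wA K j c / ZA K + wB K j c / ZB K) with hX
  set e : ℕ → ℝ := fun j => 2 * ((B j).card : ℝ) * V j / n j with he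
  have hX0 : ∀ j c, 0 ≤ X j c := fun j c =>
    sum_nonneg fun K _ => add_nonneg (div_nonneg (hA0 K j c) (hZA K).le) (div_nonneg (hB0 K j c) (hZB K).le)
  have he0 : ∀ j, 0 ≤ e j := fun j => div_nonneg (mul_nonneg (by positivity) (hV j)) (Nat.cast_nonneg _)
  -- own-level sums (L2↓) ⇒ every coordinate fibre of the truncated grid carries `X`-weight ≤ 2·#(B j)·V j
  have hown : ∀ (j : ℕ) (c : ℕ → ℕ), (∀ l, c l < n l) →
      ∑ m ∈ range (n j), X j (Function.update c j m) ≤ 2 * ((B j).card : ℝ) * V j := by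
    intro j c hc
    have hsumA : ∀ K, ∑ m ∈ range (n j), wA K j (Function.update c j m) / ZA K ≤ V j := fun K => by
      rw [← sum_div, div_le_iff₀ (hZA K)]; exact hA K j c hc
    have hsumB : ∀ K, ∑ m ∈ range (n j), wB K j (Function.update c j m) / ZB K ≤ V j := fun K => by
      rw [← sum_div, div_le_iff₀ (hZB K)]; exact hB K j c hc
    simp only [hX]
    rw [sum_comm]
    calc ∑ K ∈ B j, ∑ m ∈ range (n j),
          (wA K j (Function.update c j m) / ZA K + wB K j (Function.update c j m) / ZB K)
        ≤ ∑ K ∈ B j, (V j + V j) := sum_le_sum fun K _ => by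
          rw [sum_add_distrib]; exact add_le_add (hsumA K) (hsumB K)
      _ = 2 * ((B j).card : ℝ) * V j := by rw [sum_const, nsmul_eq_mul]; ring
  have hfib : ∀ (i : Fin J), ∀ r ∈ G,
      ∑ r' ∈ G.filter (fun r' => Function.update r' i 0 = Function.update r i 0), X i (E r')
        ≤ 2 * ((B i).card : ℝ) * V i := by
    intro i r hr
    rw [sum_filter_candGrid_update (fun i : Fin J => n i) i hr (fun r' => X i (E r'))]
    have hupd : ∀ m, E (Function.update r i m) = Function.update (E r) i m := fun m => by
      simp only [hE]; exact extend_val_update r i m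
    simp only [hupd]
    exact hown i (E r) (hEgrid r hr)
  have havg : ∀ i : Fin J, ∑ r ∈ G, X i (E r) ≤ (G.card : ℝ) * e i := by
    intro i
    have h := sum_le_of_fibres G (fun r => Function.update r i 0) (fun r => X i (E r)) (hn i)
      (fun r hr => card_filter_candGrid_update (fun i : Fin J => n i) i hr) (hfib i)
    calc ∑ r ∈ G, X i (E r) ≤ (G.card / n i) * (2 * ((B i).card : ℝ) * V i) := h
      _ = (G.card : ℝ) * e i := by simp only [he]; ring
  have hbad_i : ∀ i : Fin J,
      (((G.filter fun r => t i * e i < X i (E r)).card : ℕ) : ℝ) ≤ G.card / t i := fun i =>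
    card_filter_exceed_le G (fun r => X i (E r)) (fun r _ => hX0 i (E r)) (he0 i) (ht0 i) (havg i)
  set bad : Finset (Fin J → ℕ) := G.filter fun r => ∃ i : Fin J, t i * e i < X i (E r) with hbad
  have hbad_sub : bad ⊆ (univ : Finset (Fin J)).biUnion fun i => G.filter fun r => t i * e i < X i (E r) :=
    fun r hr => by
      obtain ⟨hrG, i, hi⟩ := mem_filter.mp hr
      exact mem_biUnion.mpr ⟨i, mem_univ i, mem_filter.mpr ⟨hrG, hi⟩⟩
  have hbad_card : (bad.card : ℝ) < G.card := by
    have hsumt : ∑ i : Fin J, (t i)⁻¹ < 1 := by rwa [Fin.sum_univ_eq_sum_range (fun j => (t j)⁻¹) J]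
    calc (bad.card : ℝ)
        ≤ (((univ : Finset (Fin J)).biUnion fun i => G.filter fun r => t i * e i < X i (E r)).card : ℝ) := by
          exact_mod_cast card_le_card hbad_sub
      _ ≤ ∑ i : Fin J, (((G.filter fun r => t i * e i < X i (E r)).card : ℕ) : ℝ) := by
          exact_mod_cast card_biUnion_le
      _ ≤ ∑ i : Fin J, (G.card : ℝ) / t i := sum_le_sum fun i _ => hbad_i i
      _ = (G.card : ℝ) * ∑ i : Fin J, (t i)⁻¹ := by
          rw [mul_sum]; exact sum_congr rfl fun i _ => by rw [div_eq_mul_inv]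
      _ < (G.card : ℝ) * 1 := mul_lt_mul_of_pos_left hsumt (Nat.cast_pos.mpr hGne.card_pos)
      _ = G.card := mul_one _
  obtain ⟨r, hrG, hrbad⟩ : ∃ r ∈ G, r ∉ bad := by
    by_contra h
    push Not at h
    exact absurd (Nat.cast_le.mpr (card_le_card fun r hr => h r hr)) (not_le.mpr hbad_card)
  have hgood : ∀ i : Fin J, X i (E r) ≤ t i * e i := fun i => by
    by_contra h'
    exact hrbad (mem_filter.mpr ⟨hrG, i, not_le.mp h'⟩)
  refine ⟨E r, hEgrid r hrG, fun l hl => ?_, fun j hj => ?_⟩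
  · simp only [hE]; exact extend_val_apply_ge r hl
  · simpa only [hX, he] using hgood ⟨j, hj⟩

/-! ## §3 All levels: compactness of the candidate grid (Tychonoff for `ℕ → ℕ`) under finite dependence -/

/-- TRUNCATION MAKES ANY WEIGHT CONTINUOUS: `c ↦ w (zero extension of c below D)` is continuous for the product
topology of `ℕ → ℕ` (it factors through the discrete space `Fin D → ℕ`). [folklore] -/
theorem continuous_comp_truncate (w : (ℕ → ℕ) → ℝ) (D : ℕ) :
    Continuous fun c : ℕ → ℕ => w (Function.extend Fin.val (fun i : Fin D => c i.val) (fun _ => 0)) := by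
  have h1 : Continuous fun c : ℕ → ℕ => fun i : Fin D => c i.val :=
    continuous_pi fun i => continuous_apply i.val
  have h2 : Continuous fun r : Fin D → ℕ => w (Function.extend Fin.val r (fun _ => 0)) :=
    continuous_of_discreteTopology
  exact h2.comp h1

/-- **ONE ASSIGNMENT FOR ALL CUTOFFS, WITHOUT (R↓).**  Hypotheses of `exists_truncated_assignment` at every truncation
height (`Σ_{j<J} 1/t j < 1` for all `J`), plus FINITE DEPENDENCE (FD): inside the candidate grid comparison `K`'s
level-`j` weights see the assignment only through the levels `< D K j`.  CONCLUSION: one grid assignment `c` with, at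
EVERY level `j`, `Σ_{K ∈ B j} (wA K j c/ZA K + wB K j c/ZB K) ≤ t j · 2·#(B j)·V j/n j`.  Proof: the sets of grid
assignments good below `J` are nonempty (§2), decreasing, closed under (FD), inside the compact grid `Π_l {0,…,n l − 1}`
— Cantor's intersection theorem. [folklore] -/
theorem exists_global_assignment_compact (n : ℕ → ℕ) (hn : ∀ j, 0 < n j) (B : ℕ → Finset ℕ)
    (wA wB : ℕ → ℕ → (ℕ → ℕ) → ℝ) (ZA ZB : ℕ → ℝ) (hZA : ∀ K, 0 < ZA K) (hZB : ∀ K, 0 < ZB K)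
    (hA0 : ∀ K j c, 0 ≤ wA K j c) (hB0 : ∀ K j c, 0 ≤ wB K j c) (V : ℕ → ℝ) (hV : ∀ j, 0 ≤ V j)
    (hA : ∀ K j (c : ℕ → ℕ), (∀ l, c l < n l) →
      ∑ m ∈ range (n j), wA K j (Function.update c j m) ≤ V j * ZA K)
    (hB : ∀ K j (c : ℕ → ℕ), (∀ l, c l < n l) →
      ∑ m ∈ range (n j), wB K j (Function.update c j m) ≤ V j * ZB K)
    (D : ℕ → ℕ → ℕ)
    (hdepA : ∀ K j (c c' : ℕ → ℕ), (∀ l, c l < n l) → (∀ l, c' l < n l) → (∀ l, l < D K j → c l = c' l) →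
      wA K j c = wA K j c')
    (hdepB : ∀ K j (c c' : ℕ → ℕ), (∀ l, c l < n l) → (∀ l, c' l < n l) → (∀ l, l < D K j → c l = c' l) →
      wB K j c = wB K j c')
    (t : ℕ → ℝ) (ht0 : ∀ j, 0 < t j) (ht : ∀ J, ∑ j ∈ range J, (t j)⁻¹ < 1) :
    ∃ c : ℕ → ℕ, (∀ j, c j < n j) ∧
      ∀ j, ∑ K ∈ B j, (wA K j c / ZA K + wB K j c / ZB K) ≤ t j * (2 * ((B j).card : ℝ) * V j / n j) := by
  classical
  -- truncations below the dependence heights: continuous proxies `Y` of the booked weights `X`, equal on the grid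
  set tr : ℕ → (ℕ → ℕ) → (ℕ → ℕ) :=
    fun Dh c => Function.extend Fin.val (fun i : Fin Dh => c i.val) (fun _ => 0) with htr
  have htr_grid : ∀ Dh c, (∀ l, c l < n l) → ∀ l, tr Dh c l < n l := fun Dh c hc =>
    extend_val_mem_grid hn (fun i => hc i.val)
  have htr_agree : ∀ Dh c l, l < Dh → tr Dh c l = c l := fun Dh c l hl => extend_val_apply_lt _ hl
  set Y : ℕ → (ℕ → ℕ) → ℝ :=
    fun j c => ∑ K ∈ B j, (wA K j (tr (D K j) c) / ZA K + wB K j (tr (D K j) c) / ZB K) with hY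
  set X : ℕ → (ℕ → ℕ) → ℝ := fun j c => ∑ K ∈ B j, (wA K j c / ZA K + wB K j c / ZB K) with hX
  have hYX : ∀ j c, (∀ l, c l < n l) → Y j c = X j c := by
    intro j c hc
    simp only [hY, hX]
    refine sum_congr rfl fun K _ => ?_
    rw [hdepA K j (tr (D K j) c) c (htr_grid _ c hc) hc (fun l hl => htr_agree _ c l hl),
      hdepB K j (tr (D K j) c) c (htr_grid _ c hc) hc (fun l hl => htr_agree _ c l hl)]
  have hYcont : ∀ j, Continuous (Y j) := fun j => by
    simp only [hY]
    refine continuous_finsetSum _ fun K _ => ?_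
    exact ((continuous_comp_truncate (wA K j) (D K j)).div_const _).add
      ((continuous_comp_truncate (wB K j) (D K j)).div_const _)
  set grid : Set (ℕ → ℕ) := Set.pi Set.univ fun l => Set.Iio (n l) with hgrid
  have hgrid_mem : ∀ c : ℕ → ℕ, c ∈ grid ↔ ∀ l, c l < n l := fun c => by
    simp only [hgrid, Set.mem_univ_pi, Set.mem_Iio]
  have hgrid_compact : IsCompact grid := isCompact_univ_pi fun l => (Set.finite_Iio (n l)).isCompact
  have hgrid_closed : IsClosed grid := isClosed_set_pi fun l _ => isClosed_discrete _
  set b : ℕ → ℝ := fun j => t j * (2 * ((B j).card : ℝ) * V j / n j) with hb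
  set good : ℕ → Set (ℕ → ℕ) := fun J => grid ∩ {c | ∀ j, j < J → Y j c ≤ b j} with hgood
  have hgood_closed : ∀ J, IsClosed (good J) := fun J => by
    have hset : {c : ℕ → ℕ | ∀ j, j < J → Y j c ≤ b j} = ⋂ j, ⋂ (_ : j < J), {c | Y j c ≤ b j} := by
      ext c; simp only [Set.mem_setOf_eq, Set.mem_iInter]
    refine hgrid_closed.inter ?_
    rw [hset]
    exact isClosed_iInter fun j => isClosed_iInter fun _ => isClosed_le (hYcont j) continuous_const
  have hgood_anti : ∀ J, good (J + 1) ⊆ good J := fun J c hc =>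
    ⟨hc.1, fun j hj => hc.2 j (Nat.lt_succ_of_lt hj)⟩
  have hgood_ne : ∀ J, (good J).Nonempty := fun J => by
    obtain ⟨c, hc, -, hcJ⟩ :=
      exists_truncated_assignment n hn B wA wB ZA ZB hZA hZB hA0 hB0 V hV hA hB t ht0 J (ht J)
    refine ⟨c, (hgrid_mem c).mpr hc, fun j hj => ?_⟩
    rw [hYX j c hc]
    simpa only [hX, hb] using hcJ j hj
  have hgood0 : IsCompact (good 0) := by
    have h0 : good 0 = grid :=
      Set.inter_eq_left.mpr fun c _ => by simp only [Set.mem_setOf_eq]; exact fun j hj => absurd hj j.not_lt_zero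
    rw [h0]; exact hgrid_compact
  obtain ⟨c, hc⟩ := IsCompact.nonempty_iInter_of_sequence_nonempty_isCompact_isClosed good hgood_anti hgood_ne
    hgood0 hgood_closed
  have hcJ : ∀ J, c ∈ good J := fun J => Set.mem_iInter.mp hc J
  have hcgrid : ∀ l, c l < n l := (hgrid_mem c).mp (hcJ 0).1
  refine ⟨c, hcgrid, fun j => ?_⟩
  simpa only [hYX j c hcgrid, hX, hb] using (hcJ (j + 1)).2 j (Nat.lt_succ_self j)

/-! ## §4 End to end: `T4IndicatorShell.ShellWeightBound` for the two runs written with ONE global assignment, (R↓)-free -/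

/-- **THE CONSTRUCTOR OF MEMBER (δ-global) WITHOUT (R↓), END TO END.**  As `LiveFactorGlobalLevels.
shellWeightBound_of_globalLevels` (assignment-indexed realized slot ledgers of both runs of every comparison — input
(L1-levelwise) —, level covers, own-level candidate sums (L2↓), floors, window majorant), with (R↓) REPLACED by finite
dependence (FD) `hdepA`∕`hdepB` and the level budgets weighted by loss factors `t j`, `Σ_{j<J} 1/t j < 1` (window
majorant `hgeo` for the weighted budgets: `window_sum_le_geometric_weighted`).  THEN one global assignment `c` realizes
`T4IndicatorShell.ShellWeightBound` BY NAME for the two runs written with the SAME `c` at every `K`. [folklore] -/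
theorem shellWeightBound_of_globalCompact {ι σ σ' : Type*} {l₀ a C ϑ : ℝ} {T : ℕ → Finset ι}
    (n : ℕ → ℕ) (hn : ∀ j, 0 < n j) (B W : ℕ → Finset ℕ) (hWB : ∀ K j, j ∈ W K → K ∈ B j)
    {A A' shA shA' : (ℕ → ℕ) → ℕ → ℝ → ι → ℝ} {SA : ℕ → Finset σ} {SA' : ℕ → Finset σ'}
    {pieceA : (ℕ → ℕ) → ℕ → ℝ → σ → ι → ℝ} {pieceA' : (ℕ → ℕ) → ℕ → ℝ → σ' → ι → ℝ}
    (hLA : ∀ c : ℕ → ℕ, (∀ j, c j < n j) → SlotLedger l₀ T (A c) (shA c) SA (pieceA c)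
      (fun K s => Real.exp (2 * a) * ((∑ τ ∈ T K, pieceA c K 0 s τ) / ∑ τ ∈ T K, A c K 0 τ)))
    (hLB : ∀ c : ℕ → ℕ, (∀ j, c j < n j) → SlotLedger l₀ T (A' c) (shA' c) SA' (pieceA' c)
      (fun K s => Real.exp (2 * a) * ((∑ τ ∈ T K, pieceA' c K 0 s τ) / ∑ τ ∈ T K, A' c K 0 τ)))
    {ZA ZB : ℕ → ℝ} (hZA : ∀ K, 0 < ZA K) (hZB : ∀ K, 0 < ZB K)
    (hZAle : ∀ c : ℕ → ℕ, (∀ j, c j < n j) → ∀ K, ZA K ≤ ∑ τ ∈ T K, A c K 0 τ)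
    (hZBle : ∀ c : ℕ → ℕ, (∀ j, c j < n j) → ∀ K, ZB K ≤ ∑ τ ∈ T K, A' c K 0 τ)
    (wA wB : ℕ → ℕ → (ℕ → ℕ) → ℝ) (hA0 : ∀ K j c, 0 ≤ wA K j c) (hB0 : ∀ K j c, 0 ≤ wB K j c)
    (D : ℕ → ℕ → ℕ)
    (hdepA : ∀ K j (c c' : ℕ → ℕ), (∀ l, c l < n l) → (∀ l, c' l < n l) → (∀ l, l < D K j → c l = c' l) →
      wA K j c = wA K j c')
    (hdepB : ∀ K j (c c' : ℕ → ℕ), (∀ l, c l < n l) → (∀ l, c' l < n l) → (∀ l, l < D K j → c l = c' l) →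
      wB K j c = wB K j c')
    (V : ℕ → ℝ) (hV : ∀ j, 0 ≤ V j)
    (hA : ∀ K j (c : ℕ → ℕ), (∀ l, c l < n l) →
      ∑ m ∈ range (n j), wA K j (Function.update c j m) ≤ V j * ZA K)
    (hB : ∀ K j (c : ℕ → ℕ), (∀ l, c l < n l) →
      ∑ m ∈ range (n j), wB K j (Function.update c j m) ≤ V j * ZB K)
    (hcovA : ∀ c : ℕ → ℕ, (∀ j, c j < n j) → ∀ K,
      ∑ s ∈ SA K, ∑ τ ∈ T K, pieceA c K 0 s τ ≤ ∑ j ∈ W K, wA K j c)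
    (hcovB : ∀ c : ℕ → ℕ, (∀ j, c j < n j) → ∀ K,
      ∑ s ∈ SA' K, ∑ τ ∈ T K, pieceA' c K 0 s τ ≤ ∑ j ∈ W K, wB K j c)
    (t : ℕ → ℝ) (ht0 : ∀ j, 0 < t j) (ht : ∀ J, ∑ j ∈ range J, (t j)⁻¹ < 1)
    (hϑ0 : 0 ≤ ϑ) (hϑ1 : ϑ < 1)
    (hgeo : ∀ K, ∑ j ∈ W K, t j * (2 * ((B j).card : ℝ) * V j / n j) ≤ C * ϑ ^ K) :
    ∃ c : ℕ → ℕ, ∃ hc : ∀ j, c j < n j,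
      T4IndicatorShell.ShellWeightBound l₀ T (A c) (A' c) (shA c) (shA' c)
        (fun K => (hLA c hc).omega K + (hLB c hc).omega K) := by
  obtain ⟨c, hc, hbud⟩ := exists_global_assignment_compact n hn B wA wB ZA ZB hZA hZB hA0 hB0 V hV hA hB D
    hdepA hdepB t ht0 ht
  have hb0 : ∀ K, 0 ≤ ∑ j ∈ W K, t j * (2 * ((B j).card : ℝ) * V j / n j) := fun K =>
    sum_nonneg fun j _ => mul_nonneg (ht0 j).le
      (div_nonneg (mul_nonneg (by positivity) (hV j)) (Nat.cast_nonneg _))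
  have hZA' : ∀ K, 0 < ∑ τ ∈ T K, A c K 0 τ := fun K => (hZA K).trans_le (hZAle c hc K)
  have hZB' : ∀ K, 0 < ∑ τ ∈ T K, A' c K 0 τ := fun K => (hZB K).trans_le (hZBle c hc K)
  refine ⟨c, hc, shellWeightBound_of_realized (hLA c hc) (hLB c hc) hZA' hZB' hϑ0 hϑ1 (C := C)
    (fun K => ?_) (fun K => ?_)⟩
  · have h := (sum_window_le_of_global hWB hZA hZB hA0 hB0 hbud K).1
    calc ∑ s ∈ SA K, ∑ τ ∈ T K, pieceA c K 0 s τ ≤ ∑ j ∈ W K, wA K j c := hcovA c hc K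
      _ ≤ (∑ j ∈ W K, t j * (2 * ((B j).card : ℝ) * V j / n j)) * ZA K := h
      _ ≤ (C * ϑ ^ K) * ∑ τ ∈ T K, A c K 0 τ :=
          mul_le_mul (hgeo K) (hZAle c hc K) (hZA K).le ((hb0 K).trans (hgeo K))
  · have h := (sum_window_le_of_global hWB hZA hZB hA0 hB0 hbud K).2
    calc ∑ s ∈ SA' K, ∑ τ ∈ T K, pieceA' c K 0 s τ ≤ ∑ j ∈ W K, wB K j c := hcovB c hc K
      _ ≤ (∑ j ∈ W K, t j * (2 * ((B j).card : ℝ) * V j / n j)) * ZB K := h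
      _ ≤ (C * ϑ ^ K) * ∑ τ ∈ T K, A' c K 0 τ :=
          mul_le_mul (hgeo K) (hZBle c hc K) (hZB K).le ((hb0 K).trans (hgeo K))

/-! ## §5 The loss factors: geometric (rate kept) and polynomial -/

/-- GEOMETRIC LOSS FACTORS `t j = (1 − η)⁻¹·η^{−j}`, `0 < η < 1`: positive … [folklore] -/
theorem geomLoss_pos {η : ℝ} (hη0 : 0 < η) (hη1 : η < 1) (j : ℕ) : 0 < (1 - η)⁻¹ * η⁻¹ ^ j :=
  mul_pos (inv_pos.mpr (by linarith)) (pow_pos (inv_pos.mpr hη0) j)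

/-- … with `Σ_{j<J} 1/t j = 1 − η^J < 1` (the hypothesis `ht` of §3–§4). [folklore] -/
theorem geomLoss_sum_inv_lt_one {η : ℝ} (hη0 : 0 < η) (hη1 : η < 1) (J : ℕ) :
    ∑ j ∈ range J, ((1 - η)⁻¹ * η⁻¹ ^ j)⁻¹ < 1 := by
  have hterm : ∀ j, ((1 - η)⁻¹ * η⁻¹ ^ j)⁻¹ = (1 - η) * η ^ j := fun j => by
    rw [mul_inv, inv_inv, inv_pow, inv_inv]
  simp only [hterm]
  rw [← mul_sum, geom_sum_eq hη1.ne J]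
  have h1 : (1 - η) * ((η ^ J - 1) / (η - 1)) = 1 - η ^ J := by
    have hne : η - 1 ≠ 0 := sub_ne_zero.mpr hη1.ne
    field_simp
    ring
  rw [h1]
  linarith [pow_pos hη0 J]

/-- **THE WEIGHTED WINDOW MAJORANT** (input `hgeo` of §4 with geometric loss factors): level budgets `e j ≤ M·ϑ^j`
weighted by `t j = (1 − η)⁻¹η^{−j}`, `ϑ ≤ η < 1`, sum over the window `[K − N₁, K]` to
`≤ ((N₁ + 1)·(M/(1 − η))·(ϑ/η)^{−N₁})·(ϑ/η)^K` — geometric at rate `ϑ/η`. [folklore] -/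
theorem window_sum_le_geometric_weighted (N₁ : ℕ) (e : ℕ → ℝ) {M ϑ η : ℝ} (hϑ0 : 0 < ϑ) (hϑη : ϑ ≤ η)
    (hη1 : η < 1) (hM : 0 ≤ M) (he : ∀ j, e j ≤ M * ϑ ^ j) (K : ℕ) :
    ∑ j ∈ Icc (K - N₁) K, (1 - η)⁻¹ * η⁻¹ ^ j * e j
      ≤ ((N₁ + 1) * (M / (1 - η)) * (ϑ / η)⁻¹ ^ N₁) * (ϑ / η) ^ K := by
  have hη0 : 0 < η := hϑ0.trans_le hϑη
  have h1η : 0 < 1 - η := by linarith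
  refine window_sum_le_geometric N₁ (fun j => (1 - η)⁻¹ * η⁻¹ ^ j * e j) (div_pos hϑ0 hη0)
    ((div_le_one hη0).mpr hϑη) (div_nonneg hM h1η.le) (fun j => ?_) K
  have ht : 0 ≤ (1 - η)⁻¹ * η⁻¹ ^ j := (geomLoss_pos hη0 hη1 j).le
  calc (1 - η)⁻¹ * η⁻¹ ^ j * e j ≤ (1 - η)⁻¹ * η⁻¹ ^ j * (M * ϑ ^ j) := mul_le_mul_of_nonneg_left (he j) ht
    _ = M / (1 - η) * (ϑ / η) ^ j := by
        rw [div_pow, inv_pow]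
        field_simp

/-- POLYNOMIAL LOSS FACTORS `t j = (j + 1)(j + 2)`: `Σ_{j<J} 1/t j = 1 − 1/(J + 1)` (so `< 1`: admissible in §3–§4,
the level budget losing a factor quadratic in the level against the geometric `ϑ^j`). [folklore] -/
theorem polyLoss_sum_inv (J : ℕ) :
    ∑ j ∈ range J, (((j : ℝ) + 1) * ((j : ℝ) + 2))⁻¹ = 1 - ((J : ℝ) + 1)⁻¹ := by
  induction J with
  | zero => simp
  | succ J ih =>
      rw [sum_range_succ, ih]
      push_cast
      have h1 : (J : ℝ) + 1 ≠ 0 := by positivity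
      have h2 : (J : ℝ) + 2 ≠ 0 := by positivity
      have h3 : (J : ℝ) + 1 + 1 ≠ 0 := by positivity
      field_simp
      ring

end Summit.QuantumFields.BalabanUV.T4Continuum.Spine.NE7c.LiveFactorGlobalCompact
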